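import Summits.Ventures.PercRepro.RankLevelSetBiIndepAbsorbParallel

/-! # RankLevelSetPerElemLow — THE PER-ELEMENT INEQUALITY (★★) AT LEVEL `1` AND THE MONOTONE STEP `j = 1` OF
THE BI-INDEPENDENT PROFILE, FOR EVERY FINITE MATROID; THE LEVEL-WISE SUM, THE LOOP AND PARALLEL-PAIR REDUCTIONS
(night-1 g35; dossier §47; the level `2` and the step `k = 3` of (ABS-star) are in `RankLevelSetPerElemTwo`)

For a finite matroid `M` on `n = #E` elements, `D_j = biIndepCount M j` is the number of bi-independent `j`-sets
(`Z` and `E ∖ Z` both independent). g24's per-element inequality (★★) at level `j` is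
`#{Z ∈ D_j : y ∉ Z} ≤ #{Q ∈ D_{j+1} : y ∈ Q}`; summed over `y ∈ E` it is the monotone step
`(n − j)·D_j ≤ (j + 1)·D_{j+1}` (`mono_step_of_perElemAt`, g24's `biIndepMono_of_perElem` level by level).

THE THREE REDUCTIONS. A loop `y` has no bi-independent set avoiding it (`perElemAt_of_isLoop`). For `y` in a
parallel pair `{y, z}` the two families are the bi-independent sets of `N = M ／ {y} ＼ {z}` one level down
(`avoid_ncard_of_parallel`, `through_ncard_of_parallel`, from g25's split bijections), so (★★) at level `j + 1` is
`D_j(N) ≤ D_{j+1}(N)`. A non-loop `y` without a parallel partner lies in the closure of no other single element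
(`notMem_closure_singleton_of_no_partner`) — the hypothesis of g34's `absorbStar_step_three` (used in
`RankLevelSetPerElemTwo`).

THEOREMS. **`perElemAt_one`**: (★★) at level `1` for every `y ∈ E` when `4 ≤ n` (loop: empty; parallel:
`D_0(N) ≤ D_1(N)` on a nonempty ground set; otherwise `Z ↦ insert y Z` is an injection into the bi-independent
`2`-sets through `y`); **`mono_step_one`**: `(n − 1) · D_1 ≤ 2 · D_2` for EVERY finite matroid with `4 ≤ n`, and
`D_1 ≤ D_2` (`biIndepCount_one_le_two`). Every declaration has a docstring; imports: the cell's own modules and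
Mathlib only. Axioms: standard. -/

namespace PercRepro

open Set Matroid

variable {α : Type} (M : Matroid α) [M.Finite]

/-! ## The per-element inequality at one level, and its sum over the elements -/

/-- **(★★) at a level, summed over the elements, is the monotone step at that level**:
`(#E − j) · D_j ≤ (j + 1) · D_{j+1}` (g24's `sum_not_mem_biIndep` and `sum_mem_biIndep`). -/
lemma mono_step_of_perElemAt (j : ℕ)
    (h : ∀ y ∈ M.E, {Z ∈ biIndep M j | y ∉ Z}.ncard ≤ {Q ∈ biIndep M (j + 1) | y ∈ Q}.ncard) :
    (M.E.ncard - j) * biIndepCount M j ≤ (j + 1) * biIndepCount M (j + 1) := by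
  have hsum : ∑ y ∈ M.ground_finite.toFinset, {Z ∈ biIndep M j | y ∉ Z}.ncard ≤
      ∑ y ∈ M.ground_finite.toFinset, {Q ∈ biIndep M (j + 1) | y ∈ Q}.ncard :=
    Finset.sum_le_sum (fun y hy => h y (M.ground_finite.mem_toFinset.mp hy))
  rwa [sum_not_mem_biIndep M j, sum_mem_biIndep M (j + 1)] at hsum

/-! ## Loops -/

omit [M.Finite] in
/-- A loop `y` lies in no independent set, so no bi-independent set avoids it. -/
lemma avoid_eq_empty_of_isLoop {y : α} (hl : M.IsLoop y) (j : ℕ) : {Z ∈ biIndep M j | y ∉ Z} = ∅ := by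
  rw [Set.eq_empty_iff_forall_notMem]
  rintro Z ⟨⟨-, -, -, hcind⟩, hyZ⟩
  exact hl.notMem_of_indep hcind ⟨hl.mem_ground, hyZ⟩

omit [M.Finite] in
/-- (★★) at every level holds trivially at a loop. -/
lemma perElemAt_of_isLoop {y : α} (hl : M.IsLoop y) (j : ℕ) :
    {Z ∈ biIndep M j | y ∉ Z}.ncard ≤ {Q ∈ biIndep M (j + 1) | y ∈ Q}.ncard := by
  rw [avoid_eq_empty_of_isLoop M hl j, Set.ncard_empty]
  exact Nat.zero_le _

/-! ## A parallel pair: both families are the bi-independent sets of the minor one level down -/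

/-- For a parallel pair `{y, z}`, the bi-independent `(j+1)`-sets avoiding `y` are those through `z`, i.e. the
bi-independent `j`-sets of `N = M ／ {y} ＼ {z}`: `#{Z ∈ D_{j+1} : y ∉ Z} = D_j(N)`. -/
lemma avoid_ncard_of_parallel {y z : α} (h : ParallelPair M y z) (j : ℕ) :
    {Z ∈ biIndep M (j + 1) | y ∉ Z}.ncard = biIndepCount ((M.contract {y}).delete {z}) j := by
  have hsplit := ncard_biIndep_split M h (j + 1) (fun S => y ∉ S)
  have hr := ncard_biIndep_mem_right_eq M h j (fun S => y ∉ S)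
  have h0 : {S | S ∈ biIndep M (j + 1) ∧ y ∈ S ∧ y ∉ S} = ∅ := by
    rw [Set.eq_empty_iff_forall_notMem]
    rintro S ⟨-, hy, hny⟩
    exact hny hy
  have hN : {T | T ∈ biIndep ((M.contract {y}).delete {z}) j ∧ y ∉ insert z T} =
      biIndep ((M.contract {y}).delete {z}) j := by
    ext T
    simp only [Set.mem_setOf_eq, and_iff_left_iff_imp]
    intro hT hyT
    have hTE := hT.1
    rw [ground_contract_delete] at hTE
    rcases hyT with rfl | hyT
    · exact h.1 rfl
    · exact (hTE hyT).2 (Set.mem_insert _ _)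
  change {S | S ∈ biIndep M (j + 1) ∧ y ∉ S}.ncard = _
  rw [hsplit, h0, Set.ncard_empty, Nat.zero_add, hr, hN]
  rfl

/-- For a parallel pair `{y, z}`, the bi-independent `(j+1)`-sets through `y` are the bi-independent `j`-sets
of `N = M ／ {y} ＼ {z}`: `#{Q ∈ D_{j+1} : y ∈ Q} = D_j(N)`. -/
lemma through_ncard_of_parallel {y z : α} (h : ParallelPair M y z) (j : ℕ) :
    {Q ∈ biIndep M (j + 1) | y ∈ Q}.ncard = biIndepCount ((M.contract {y}).delete {z}) j := by
  have hl := ncard_biIndep_mem_left_eq M h j (fun _ => True)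
  have e1 : {S | S ∈ biIndep M (j + 1) ∧ y ∈ S ∧ True} = {Q | Q ∈ biIndep M (j + 1) ∧ y ∈ Q} := by
    ext S; simp only [Set.mem_setOf_eq, and_true]
  have e2 : {T | T ∈ biIndep ((M.contract {y}).delete {z}) j ∧ True} =
      biIndep ((M.contract {y}).delete {z}) j := by
    ext T; simp only [Set.mem_setOf_eq, and_true]
  rw [e1, e2] at hl
  exact hl

/-- The minor `M ／ {y} ＼ {z}` of a finite matroid is finite. -/
lemma contract_delete_finite (y z : α) : ((M.contract {y}).delete {z}).Finite :=
  ⟨M.ground_finite.subset (by rw [ground_contract_delete]; exact Set.sdiff_subset)⟩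

/-! ## Level `0` and level `1` -/

/-- The only candidate bi-independent `0`-set is `∅`, so `D_0 ≤ 1`. -/
lemma biIndepCount_zero_le_one : biIndepCount M 0 ≤ 1 := by
  unfold biIndepCount
  have hsub : biIndep M 0 ⊆ {∅} := by
    rintro Z ⟨hZE, hZ0, -, -⟩
    have hfin : Z.Finite := M.ground_finite.subset hZE
    rw [Set.mem_singleton_iff]
    exact (Set.ncard_eq_zero hfin).mp hZ0
  calc (biIndep M 0).ncard ≤ ({∅} : Set (Set α)).ncard := Set.ncard_le_ncard hsub (Set.finite_singleton _)
    _ = 1 := Set.ncard_singleton _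

omit [M.Finite] in
/-- If `∅` is bi-independent (the ground set is independent), every singleton `{t}`, `t ∈ E`, is
bi-independent. -/
lemma singleton_mem_biIndep_of_empty_mem (h0 : (∅ : Set α) ∈ biIndep M 0) {t : α} (ht : t ∈ M.E) :
    {t} ∈ biIndep M 1 := by
  obtain ⟨-, -, -, hE⟩ := h0
  rw [Set.sdiff_empty] at hE
  refine ⟨Set.singleton_subset_iff.mpr ht, Set.ncard_singleton t, hE.subset (Set.singleton_subset_iff.mpr ht),
    hE.subset Set.sdiff_subset⟩

/-- **`D_0 ≤ D_1` on a nonempty ground set.** -/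
lemma biIndepCount_zero_le_one_count (hE : M.E.Nonempty) : biIndepCount M 0 ≤ biIndepCount M 1 := by
  by_cases h0 : (∅ : Set α) ∈ biIndep M 0
  · obtain ⟨t, ht⟩ := hE
    have h1 : 1 ≤ biIndepCount M 1 := by
      unfold biIndepCount
      exact (Set.ncard_pos (biIndep_finite M 1)).mpr ⟨{t}, singleton_mem_biIndep_of_empty_mem M h0 ht⟩
    exact (biIndepCount_zero_le_one M).trans h1
  · have : biIndep M 0 = ∅ := by
      rw [Set.eq_empty_iff_forall_notMem]
      intro Z hZ
      have hZe : Z = ∅ := (Set.ncard_eq_zero (M.ground_finite.subset hZ.1)).mp hZ.2.1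
      rw [hZe] at hZ
      exact h0 hZ
    unfold biIndepCount
    rw [this, Set.ncard_empty]
    exact Nat.zero_le _

omit [M.Finite] in
/-- A non-loop `y` without a parallel partner lies in the closure of no other single element. -/
lemma notMem_closure_singleton_of_no_partner {y : α} (hy : y ∈ M.E) (hnl : ¬ M.IsLoop y)
    (hnp : ∀ z, ¬ ParallelPair M y z) {z : α} (hz : z ≠ y) : y ∉ M.closure {z} := by
  intro hycl
  by_cases hzl : M.IsLoop z
  · rw [hzl.closure] at hycl
    exact hnl hycl
  by_cases hzE : z ∈ M.E
  · have hzn : M.IsNonloop z := Matroid.isNonloop_of_not_isLoop hzE hzl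
    have hyn : M.IsNonloop y := Matroid.isNonloop_of_not_isLoop hy hnl
    refine hnp z ⟨hz.symm, hyn, hzn, fun hind => ?_⟩
    have hzi : M.Indep {z} := Matroid.indep_singleton.mpr hzn
    have : M.Indep (insert y {z}) := by
      rw [Set.insert_eq, Set.union_singleton] at *
      exact hind
    rw [hzi.insert_indep_iff_of_notMem (by simpa using hz.symm)] at this
    exact this.2 hycl
  · have hcl : M.closure {z} = M.loops := by
      rw [← M.closure_inter_ground, Set.singleton_inter_eq_empty.mpr hzE]
      rfl
    rw [hcl] at hycl
    exact hnl hycl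

/-- **(★★) AT LEVEL `1` FOR EVERY ELEMENT OF EVERY FINITE MATROID WITH `4 ≤ #E`**:
`#{Z ∈ D_1 : y ∉ Z} ≤ #{Q ∈ D_2 : y ∈ Q}`. -/
theorem perElemAt_one {y : α} (hy : y ∈ M.E) (hn : 4 ≤ M.E.ncard) :
    {Z ∈ biIndep M 1 | y ∉ Z}.ncard ≤ {Q ∈ biIndep M 2 | y ∈ Q}.ncard := by
  by_cases hl : M.IsLoop y
  · exact perElemAt_of_isLoop M hl 1
  by_cases hp : ∃ z, ParallelPair M y z
  · obtain ⟨z, hz⟩ := hp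
    haveI := contract_delete_finite M y z
    rw [avoid_ncard_of_parallel M hz 0, through_ncard_of_parallel M hz 1]
    apply biIndepCount_zero_le_one_count
    rw [← Set.ncard_pos ((contract_delete_finite M y z).ground_finite), ncard_ground_contract_delete M hz]
    omega
  simp only [not_exists] at hp
  have hnp : ∀ z, z ≠ y → y ∉ M.closure {z} := fun z hz =>
    notMem_closure_singleton_of_no_partner M hy hl hp hz
  refine Set.ncard_le_ncard_of_injOn (fun Z => insert y Z) ?_ ?_ ((biIndep_finite M 2).subset (fun Q hQ => hQ.1))
  · rintro Z ⟨⟨hZE, hZ1, hZi, hcind⟩, hyZ⟩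
    obtain ⟨a, rfl⟩ := Set.ncard_eq_one.mp hZ1
    have hay : a ≠ y := fun h => hyZ (by rw [h]; exact Set.mem_singleton y)
    refine ⟨⟨Set.insert_subset hy hZE, ?_, ?_, hcind.subset ?_⟩, Set.mem_insert y _⟩
    · rw [Set.ncard_insert_of_notMem hyZ (Set.finite_singleton a), Set.ncard_singleton]
    · rw [hZi.insert_indep_iff_of_notMem hyZ]
      exact ⟨hy, hnp a hay⟩
    · exact Set.sdiff_subset_sdiff_right (Set.subset_insert y _)
  · rintro Z₁ ⟨-, hy₁⟩ Z₂ ⟨-, hy₂⟩ heq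
    have heq' : insert y Z₁ = insert y Z₂ := heq
    have : (insert y Z₁) \ {y} = (insert y Z₂) \ {y} := by rw [heq']
    rwa [Set.insert_sdiff_of_mem _ (Set.mem_singleton y), Set.insert_sdiff_of_mem _ (Set.mem_singleton y),
      Set.sdiff_singleton_eq_self hy₁, Set.sdiff_singleton_eq_self hy₂] at this

/-- **THE MONOTONE STEP `j = 1` OF EVERY FINITE MATROID WITH `4 ≤ #E`**: `(#E − 1) · D_1 ≤ 2 · D_2`. -/
theorem mono_step_one (hn : 4 ≤ M.E.ncard) : (M.E.ncard - 1) * biIndepCount M 1 ≤ 2 * biIndepCount M 2 :=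
  mono_step_of_perElemAt M 1 (fun _ hy => perElemAt_one M hy hn)

/-- **`D_1 ≤ D_2` on `4` or more elements.** -/
lemma biIndepCount_one_le_two (hn : 4 ≤ M.E.ncard) : biIndepCount M 1 ≤ biIndepCount M 2 := by
  have h := mono_step_one M hn
  have h3 : 3 * biIndepCount M 1 ≤ (M.E.ncard - 1) * biIndepCount M 1 := Nat.mul_le_mul_right _ (by omega)
  omega

/-! ## A lemma on lines -/

omit [M.Finite] in
/-- **At most one element of an independent set `J ∋ e` lies on the line through `y` and `e`** (`y ∉ cl {e}`):
two distinct `e', e'' ∈ J ∖ {e}` with `y ∈ cl {e, e'}` and `y ∈ cl {e, e''}` would put the independent `3`-set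
`{e, e', e''}` into the rank-`2` flat `cl {y, e}` (by the exchange property of the closure). So if `J ∖ {e}` has at
least two elements, one of them is off the line. -/
lemma exists_off_line {y e : α} (hy : y ∈ M.E) (hye : y ∉ M.closure {e}) {J : Set α} (hJ : M.Indep J)
    (hJfin : J.Finite) (heJ : e ∈ J) (hJ2 : 2 ≤ (J \ {e}).ncard) :
    ∃ e' ∈ J, e' ≠ e ∧ y ∉ M.closure {e, e'} := by
  by_contra hcon
  simp only [not_exists, not_and, not_not] at hcon
  obtain ⟨e', e'', he', he'', hne⟩ :=
    (Set.one_lt_ncard_iff (hJfin.subset Set.sdiff_subset)).mp (by omega : 1 < (J \ {e}).ncard)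
  have key : ∀ f ∈ J \ {e}, f ∈ M.closure (insert y {e}) := by
    intro f hf
    have h1 : y ∈ M.closure (insert f {e}) \ M.closure {e} := by
      refine ⟨?_, hye⟩
      have := hcon f hf.1 hf.2
      rwa [Set.pair_comm] at this
    exact (Matroid.closure_exchange h1).1
  have hsub : ({e, e', e''} : Set α) ⊆ M.closure (insert y {e}) := by
    rintro x (rfl | rfl | rfl)
    · exact M.subset_closure _ (Set.insert_subset hy (Set.singleton_subset_iff.mpr (hJ.subset_ground heJ))) (Set.mem_insert_of_mem _ rfl)
    · exact key _ he'
    · exact key _ he''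
  have hind : M.Indep ({e, e', e''} : Set α) := hJ.subset (by
    rintro x (rfl | rfl | rfl)
    · exact heJ
    · exact he'.1
    · exact he''.1)
  have h3 : ({e, e', e''} : Set α).encard = 3 := by
    rw [Set.encard_insert_of_notMem, Set.encard_insert_of_notMem, Set.encard_singleton]
    · rfl
    · simpa using hne
    · simp only [Set.mem_insert_iff, Set.mem_singleton_iff, not_or]
      exact ⟨fun h => he'.2 (by simp [h]), fun h => he''.2 (by simp [h])⟩
  have hle : ({e, e', e''} : Set α).encard ≤ M.eRk (insert y {e}) := by
    calc ({e, e', e''} : Set α).encard ≤ M.eRk (M.closure (insert y {e})) := hind.encard_le_eRk_of_subset hsub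
      _ = M.eRk (insert y {e}) := M.eRk_closure_eq _
  have h2 : M.eRk (insert y {e}) ≤ 2 := by
    calc M.eRk (insert y {e}) ≤ (insert y {e} : Set α).encard := M.eRk_le_encard _
      _ ≤ ({e} : Set α).encard + 1 := Set.encard_insert_le _ _
      _ = 2 := by rw [Set.encard_singleton]; rfl
  rw [h3] at hle
  have : (3 : ℕ∞) ≤ 2 := hle.trans h2
  exact absurd this (by decide)

end PercRepro
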